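import Literature.MathematicalPhysics.QuantumLattice.YangMillsHeatFlowHessianBochner
import Literature.MathematicalPhysics.QuantumLattice.YangMillsHeatFlowScalarEnergy
import Literature.MathematicalPhysics.QuantumLattice.YangMillsHeatFlowGradientRegularity
import HarnessLib

/-!
# `ε`-regularity for the Yang–Mills flow in dimension four: the Hessian bound (`k = 2`)

QuantumLattice support file (everything proved; no definitions, no named facts) on the proof
path of `Literature.MathematicalPhysics.QuantumLattice.Waldron2019_yangMillsFlow_flatTorus`
(A. Waldron, Invent. math. 217 (2019)), §3, Prop. 3.1(a) for `k = 2` (after [instantons]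
Lemma 3.1), flat setting: with `N = |∇F|²`, `P = |∇²F|² = ∑_{awuv}‖D_aD_wF(b_u,b_v)‖²`,

  `sup_{[τ−R², τ]} ∫_{B_R(x₀)} e ≤ ε < ε₀ ⟹ P(t, x) ≤ C ε R⁻⁸`

for `t ∈ [τ − R²/2, τ]`, `x ∈ B̄_{R/2}(x₀)`, i.e. `‖∇²F(t)‖_{L^∞(B_{R/2})} ≤ C R⁻⁴ √ε`. Together
with the `k = 0, 1` cases this controls Waldron's `e(r, t) = r² sup (|F| + r|∇F| + r²|∇²F|)` (§4.3).

Proof: on `[t − R²/8, t] × B̄_{R/4}(x)` one has `e ≤ M = 256Kε R⁻⁴` and `N ≤ 64 C_a ε R⁻⁶`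
(`Waldron2019_prop_3_1a_k1` for `B_{R/2}(x)`); there the Bochner inequality for `P`
(`deriv_hessDensity_sub_laplacian_le` with `θ ∝ ρ⁻²`, `ρ = R/8`) reads `∂ₜP − ΔP ≤ ΛP + S₀`,
`Λρ² ≤ 1`, with a constant source `S₀ ∝ ρ² N₀²`; the mean-value inequality with source and the
generic localized `L²` bound for the pair `(N, P)`
(`intervalIntegral_integral_sq_mul_le_of_subsolution_pair`, fed by the Bochner inequality for `N`)
give the claim.

* `contDiffOn_covDeriv_joint` — `(t, y) ↦ D_w Φ(t)(y)` is jointly smooth for `Φ` jointly smooth;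
* `Waldron2019_prop_3_1a_k2` — the statement above.

References: A. Waldron, Invent. math. 217 (2019), Prop. 3.1(a) [Waldron2019]; A. Waldron,
Calc. Var. PDE 55 (2016), Lemma 3.1 [Waldron2016].
-/

noncomputable section

open scoped ContDiff Topology RealInnerProductSpace Matrix NNReal ENNReal
open Set Filter MeasureTheory Metric

namespace Literature.MathematicalPhysics.QuantumLattice

section HessRegularity

open scoped Matrix.Norms.Frobenius

attribute [local instance] frobeniusInnerProductSpace

variable {m : Type*} [Fintype m] [DecidableEq m]
variable {E : Type*} [NormedAddCommGroup E] [InnerProductSpace ℝ E] [FiniteDimensional ℝ E]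
  [MeasurableSpace E] [BorelSpace E]
variable {ι : Type*} [Fintype ι] [LinearOrder ι]

/-- Finite differentiability orders are below `∞`. [folklore] -/
private theorem natCast_le_infty₁₅ (n : ℕ) : (n : WithTop ℕ∞) ≤ (⊤ : ℕ∞) := by
  exact_mod_cast le_top

omit [FiniteDimensional ℝ E] [MeasurableSpace E] [BorelSpace E] [LinearOrder ι] in
/-- The index type of an orthonormal basis of a `4`-dimensional space has `4` elements.
[folklore] -/
private theorem card_eq_four_of_finrank₃ (hE : Module.finrank ℝ E = 4)
    (b : OrthonormalBasis ι ℝ E) : (Fintype.card ι : ℝ) = 4 := by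
  have h := Module.finrank_eq_card_basis b.toBasis
  rw [hE] at h
  exact_mod_cast h.symm

omit [MeasurableSpace E] [BorelSpace E] [LinearOrder ι] [Fintype ι] [FiniteDimensional ℝ E] in
/-- **Covariant derivatives of jointly smooth sections are jointly smooth**: for `A` and `Φ`
jointly smooth on `𝒯 × E` (`𝒯` open), so is `(t, y) ↦ D_w Φ(t)(y)`. [folklore] -/
theorem contDiffOn_covDeriv_joint {A : ℝ → Connection E (Matrix m m ℂ)} {𝒯 : Set ℝ}
    (h𝒯 : IsOpen 𝒯) (hA : ContDiffOn ℝ ∞ (fun p : ℝ × E => A p.1 p.2) (𝒯 ×ˢ (univ : Set E)))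
    {Φ : ℝ → E → Matrix m m ℂ}
    (hΦ : ContDiffOn ℝ ∞ (fun p : ℝ × E => Φ p.1 p.2) (𝒯 ×ˢ (univ : Set E))) (w : E) :
    ContDiffOn ℝ ∞ (fun p : ℝ × E => covDeriv (A p.1) (Φ p.1) p.2 w) (𝒯 ×ˢ (univ : Set E)) := by
  have hO : IsOpen (𝒯 ×ˢ (univ : Set E)) := h𝒯.prod isOpen_univ
  have hΦ' : ContDiffOn ℝ ∞ (fun p : ℝ × E =>
      fderiv ℝ (fun p : ℝ × E => Φ p.1 p.2) p ((0 : ℝ), w)) (𝒯 ×ˢ (univ : Set E)) :=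
    ((hΦ.fderiv_of_isOpen hO (m := ∞) (by norm_cast)).clm_apply contDiffOn_const)
  have hAw : ContDiffOn ℝ ∞ (fun p : ℝ × E => A p.1 p.2 w) (𝒯 ×ˢ (univ : Set E)) :=
    hA.clm_apply contDiffOn_const
  have hbr : ContDiffOn ℝ ∞ (fun p : ℝ × E => ⁅A p.1 p.2 w, Φ p.1 p.2⁆) (𝒯 ×ˢ (univ : Set E)) := by
    have h := (hAw.mul hΦ).sub (hΦ.mul hAw)
    simp only [Ring.lie_def]
    exact h
  refine (hΦ'.add hbr).congr fun p hp => ?_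
  obtain ⟨t, y⟩ := p
  change covDeriv (A t) (Φ t) y w = _
  unfold covDeriv
  rw [fderiv_spaceSlice_apply hO hΦ (by simp) hp w]
  rfl

set_option maxHeartbeats 1600000 in
-- (a long assembly proof)
/-- **`ε`-regularity, Hessian bound (Waldron 2019, Prop. 3.1(a), `k = 2`; flat setting, proved).**
There are `ε₀ = ε₀(E, ι) > 0` and `C = C(E, ι)` such that for every jointly smooth `𝔲(m)`-valued
solution `A` of the Yang–Mills heat equation on an open time set `𝒯 ⊇ [τ − R², τ]` (`R > 0`)
with `sup_{t ∈ [τ−R², τ]} ∫_{B_R(x₀)} e(t) ≤ ε < ε₀`, for all `t ∈ [τ − R²/2, τ]` and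
`x ∈ B̄_{R/2}(x₀)`: `∑_{awuv} ‖D_{b_a}D_{b_w}F(b_u,b_v)(t, x)‖² ≤ C ε R⁻⁸` — the `k = 2` case of
`‖∇^{(k)}F(t)‖_{L^∞(B_{R/2})} ≤ C_k R^{-2-k} √ε`.
[cite: Waldron2019, Prop. 3.1(a) (k = 2); Waldron2016, Lemma 3.1] -/
theorem Waldron2019_prop_3_1a_k2 (hE : Module.finrank ℝ E = 4) (b : OrthonormalBasis ι ℝ E) :
    ∃ ε₀ : ℝ, 0 < ε₀ ∧ ∃ C : ℝ, 0 < C ∧ ∀ {A : ℝ → Connection E (Matrix m m ℂ)} {𝒯 : Set ℝ},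
      IsOpen 𝒯 → ContDiffOn ℝ ∞ (fun p : ℝ × E => A p.1 p.2) (𝒯 ×ˢ (univ : Set E)) →
      (∀ ⦃s : ℝ⦄, s ∈ 𝒯 → (A s).IsValuedIn (skewAdjoint.submodule ℝ (Matrix m m ℂ))) →
      (∀ ⦃s : ℝ⦄, s ∈ 𝒯 → ∀ y w, deriv (fun s' => A s' y w) s = divCurvature (A s) y w) →
      ∀ (x₀ : E) {R : ℝ}, 0 < R → ∀ {τ : ℝ}, Icc (τ - R ^ 2) τ ⊆ 𝒯 →
      ∀ {ε : ℝ}, ε < ε₀ →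
      (∀ t ∈ Icc (τ - R ^ 2) τ, ∫ y in ball x₀ R, ymDensityOfBasis b (A t) y ≤ ε) →
      ∀ t ∈ Icc (τ - R ^ 2 / 2) τ, ∀ x ∈ closedBall x₀ (R / 2),
        (∑ a, ∑ w, ∑ u, ∑ v, ‖covDeriv (A t) (fun y' => covDeriv (A t) (fun z => curvature (A t) z (b u) (b v)) y' (b w)) x (b a)‖ ^ 2) ≤ C * ε / R ^ 8 := by
  obtain ⟨ε₁, hε₁, K, hK, hSch⟩ := sup_weighted_ymDensity_le (m := m) hE b
  obtain ⟨εa, hεa, Ca, hCa, hPa⟩ := Waldron2019_prop_3_1a_k1 (m := m) hE b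
  obtain ⟨Cmv, hCmv, hMV⟩ :=
    Analysis.PDE.le_mul_integral_add_of_linear_subsolution_source_basis (E := E) b
  obtain ⟨M', hM'0, hrad⟩ := Literature.Analysis.Calculus.exists_radial_cutoff_gradient_le (E := E)
  have hcard : (Fintype.card ι : ℝ) = 4 := card_eq_four_of_finrank₃ hE b
  have hcardpos : (0 : ℝ) < Fintype.card ι := by rw [hcard]; norm_num
  set A₅ : ℝ := 24 * Real.sqrt 2 * (Fintype.card ι : ℝ) with hA₅
  set A₇ : ℝ := 32 * Real.sqrt 2 * (Fintype.card ι : ℝ) * (1 + (Fintype.card ι : ℝ) ^ 4) with hA₇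
  have hA₅pos : 0 < A₅ := by rw [hA₅]; positivity
  have hA₇pos : 0 < A₇ := by rw [hA₇]; positivity
  set v₁ : ℝ := (volume (closedBall (0 : E) 1)).toReal with hv₁
  have hv₁0 : 0 ≤ v₁ := ENNReal.toReal_nonneg
  clear_value v₁
  set ε₀ : ℝ := min (min (min ε₁ 1) εa) (min (16 / (A₇ ^ 2 * K)) (16 / (A₅ ^ 2 * K))) with hε₀
  have hε₀pos : 0 < ε₀ :=
    lt_min (lt_min (lt_min hε₁ one_pos) hεa) (lt_min (by positivity) (by positivity))
  set C : ℝ := Cmv * Ca * (8 ^ 6 * (2 + 4 * M' ^ 2) * v₁ / 4 + 288 * (Fintype.card ι : ℝ) ^ 6 * Ca) + 1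
    with hC
  refine ⟨ε₀, hε₀pos, C, by positivity, ?_⟩
  intro A 𝒯 h𝒯 hA hval hpde x₀ R hR τ hI ε hε hsmall t ht x hx
  have hR2 : 0 < R ^ 2 := by positivity
  have hR4 : 0 < R ^ 4 := by positivity
  have hR6 : 0 < R ^ 6 := by positivity
  have hR8 : 0 < R ^ 8 := by positivity
  -- the smallness conditions unpacked
  have hε₁' : ε < ε₁ := lt_of_lt_of_le hε ((min_le_left _ _).trans ((min_le_left _ _).trans (min_le_left _ _)))
  have hε1 : ε ≤ 1 := (le_of_lt hε).trans ((min_le_left _ _).trans ((min_le_left _ _).trans (min_le_right _ _)))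
  have hεa' : ε < εa := lt_of_lt_of_le hε ((min_le_left _ _).trans (min_le_right _ _))
  have hε7 : ε ≤ 16 / (A₇ ^ 2 * K) := (le_of_lt hε).trans ((min_le_right _ _).trans (min_le_left _ _))
  have hε5 : ε ≤ 16 / (A₅ ^ 2 * K) := (le_of_lt hε).trans ((min_le_right _ _).trans (min_le_right _ _))
  clear_value ε₀ C
  have he0 : ∀ s y, 0 ≤ ymDensityOfBasis b (A s) y := fun s y => ymDensityOfBasis_nonneg b _ y
  have hN0 : ∀ s y, 0 ≤ (∑ i, ∑ j, ∑ k, ‖covDeriv (A s) (fun z => curvature (A s) z (b j) (b k)) y (b i)‖ ^ 2) := fun s y =>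
    Finset.sum_nonneg fun _ _ => Finset.sum_nonneg fun _ _ => Finset.sum_nonneg fun _ _ => sq_nonneg _
  have hP0 : ∀ s y, 0 ≤ (∑ a, ∑ w, ∑ u, ∑ v, ‖covDeriv (A s) (fun y' => covDeriv (A s) (fun z => curvature (A s) z (b u) (b v)) y' (b w)) y (b a)‖ ^ 2) := fun s y =>
    Finset.sum_nonneg fun _ _ => Finset.sum_nonneg fun _ _ => Finset.sum_nonneg fun _ _ =>
      Finset.sum_nonneg fun _ _ => sq_nonneg _
  have he_joint := contDiffOn_ymDensityOfBasis_joint_infty b h𝒯 hA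
  have he_cont : ContinuousOn (fun q : ℝ × E => ymDensityOfBasis b (A q.1) q.2)
      (𝒯 ×ˢ (univ : Set E)) := he_joint.continuousOn
  have hDF_joint : ∀ i j k, ContDiffOn ℝ ∞ (fun p : ℝ × E =>
      covDeriv (A p.1) (fun z => curvature (A p.1) z (b j) (b k)) p.2 (b i)) (𝒯 ×ˢ (univ : Set E)) :=
    fun i j k => contDiffOn_covDeriv_curvature_joint h𝒯 hA (b j) (b k) (b i)
  have hN_joint : ContDiffOn ℝ ∞ (fun p : ℝ × E => (∑ i, ∑ j, ∑ k, ‖covDeriv (A p.1) (fun z => curvature (A p.1) z (b j) (b k)) p.2 (b i)‖ ^ 2)) (𝒯 ×ˢ (univ : Set E)) :=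
    ContDiffOn.sum fun i _ => ContDiffOn.sum fun j _ => ContDiffOn.sum fun k _ =>
      (hDF_joint i j k).norm_sq ℝ
  have hN_cont := hN_joint.continuousOn
  have hP_joint : ContDiffOn ℝ ∞ (fun p : ℝ × E => (∑ a, ∑ w, ∑ u, ∑ v, ‖covDeriv (A p.1) (fun y' => covDeriv (A p.1) (fun z => curvature (A p.1) z (b u) (b v)) y' (b w)) p.2 (b a)‖ ^ 2)) (𝒯 ×ˢ (univ : Set E)) :=
    ContDiffOn.sum fun a _ => ContDiffOn.sum fun w _ => ContDiffOn.sum fun u _ =>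
      ContDiffOn.sum fun v _ => (contDiffOn_covDeriv_joint h𝒯 hA
        (Φ := fun s y => covDeriv (A s) (fun z => curvature (A s) z (b u) (b v)) y (b w))
        (hDF_joint w u v) (b a)).norm_sq ℝ
  have hP_cont := hP_joint.continuousOn
  have hε0 : 0 ≤ ε :=
    (setIntegral_nonneg (μ := volume) (s := ball x₀ R) (f := fun y => ymDensityOfBasis b (A τ) y)
      measurableSet_ball fun y _ => he0 τ y).trans (hsmall τ ⟨by linarith, le_rfl⟩)
  have hx' : dist x x₀ ≤ R / 2 := mem_closedBall.1 hx
  -- ### part (a), `k = 0`: `e ≤ M = 256 K ε R⁻⁴` on `[τ − 9R²/16, τ] × B̄_{3R/4}(x₀)`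
  have hreg : ∀ s ∈ Icc (τ - (3 * R / 4) ^ 2) τ, ∀ y ∈ closedBall x₀ (3 * R / 4),
      ymDensityOfBasis b (A s) y ≤ 256 * K * ε / R ^ 4 := by
    intro s hs y hy
    have h := hSch h𝒯 hA hval hpde x₀ hR hI hε₁' hsmall
      (by positivity : (0 : ℝ) ≤ 3 * R / 4) (by linarith : 3 * R / 4 ≤ R) s hs y hy
    rw [show (R - 3 * R / 4) ^ 4 = R ^ 4 / 256 by ring] at h
    rw [le_div_iff₀ hR4]
    linarith
  -- ### the data centered at `x` with radius `R/2`
  have hρpos : 0 < R / 8 := by positivity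
  have hρ2 : 0 ≤ (R / 8) ^ 2 := sq_nonneg _
  have hIhalf : Icc (t - (R / 2) ^ 2) t ⊆ Icc (τ - R ^ 2) τ := fun s hs =>
    ⟨by nlinarith only [hs.1, ht.1, hR2], hs.2.trans ht.2⟩
  have hIhalf𝒯 : Icc (t - (R / 2) ^ 2) t ⊆ 𝒯 := hIhalf.trans hI
  have hballhalf : ball x (R / 2) ⊆ ball x₀ R := fun y hy =>
    mem_ball.2 (by linarith only [mem_ball.1 hy, dist_triangle y x x₀, hx'])
  have heI : ∀ ⦃s : ℝ⦄, s ∈ 𝒯 → ∀ (c : E) (r : ℝ),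
      IntegrableOn (fun y => ymDensityOfBasis b (A s) y) (closedBall c r) := fun s hs c r =>
    (continuous_slice_of_continuousOn_slab he_cont hs).continuousOn.integrableOn_compact
      (isCompact_closedBall c r)
  have hsmallhalf : ∀ s ∈ Icc (t - (R / 2) ^ 2) t,
      (∫ y in ball x (R / 2), ymDensityOfBasis b (A s) y) ≤ ε := fun s hs =>
    (setIntegral_mono_set ((heI (hI (hIhalf hs)) x₀ R).mono_set ball_subset_closedBall)
      (ae_of_all _ fun y => he0 s y) hballhalf.eventuallyLE).trans (hsmall s (hIhalf hs))
  -- `N ≤ N₀` on `[t − R²/8, t] × B̄_{R/4}(x)`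
  have hNhalf : ∀ s ∈ Icc (t - (R / 2) ^ 2 / 2) t, ∀ y ∈ closedBall x (R / 2 / 2),
      (∑ i, ∑ j, ∑ k, ‖covDeriv (A s) (fun z => curvature (A s) z (b j) (b k)) y (b i)‖ ^ 2) ≤ Ca * ε / (R / 2) ^ 6 :=
    hPa h𝒯 hA hval hpde x (by positivity) hIhalf𝒯 hεa' hsmallhalf
  set N₀ : ℝ := 64 * Ca * ε / R ^ 6 with hN₀def
  have hN₀0 : 0 ≤ N₀ := by positivity
  have hregN : ∀ s ∈ Icc (t - (R / 8) ^ 2) t, ∀ y ∈ closedBall x (R / 4), (∑ i, ∑ j, ∑ k, ‖covDeriv (A s) (fun z => curvature (A s) z (b j) (b k)) y (b i)‖ ^ 2) ≤ N₀ := by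
    intro s hs y hy
    have hs' : s ∈ Icc (t - (R / 2) ^ 2 / 2) t := ⟨by nlinarith only [hs.1, hR2], hs.2⟩
    have hy' : y ∈ closedBall x (R / 2 / 2) := by rw [show R / 2 / 2 = R / 4 by ring]; exact hy
    have h := hNhalf s hs' y hy'
    rw [hN₀def, show 64 * Ca * ε / R ^ 6 = Ca * ε / (R / 2) ^ 6 by field_simp; ring]
    exact h
  clear_value N₀
  have hrege : ∀ s ∈ Icc (t - (R / 8) ^ 2) t, ∀ y, dist y x < R / 4 →
      ymDensityOfBasis b (A s) y ≤ 256 * K * ε / R ^ 4 := by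
    intro s hs y hy
    refine hreg s ⟨by nlinarith only [hs.1, ht.1, hR2], hs.2.trans ht.2⟩ y (mem_closedBall.2 ?_)
    linarith only [dist_triangle y x x₀, hy, hx']
  have hrege' : ∀ s ∈ Icc (t - (R / 8) ^ 2) t, ∀ y ∈ closedBall x (R / 4),
      ymDensityOfBasis b (A s) y ≤ 256 * K * ε / R ^ 4 := by
    intro s hs y hy
    refine hreg s ⟨by nlinarith only [hs.1, ht.1, hR2], hs.2.trans ht.2⟩ y (mem_closedBall.2 ?_)
    linarith only [dist_triangle y x x₀, mem_closedBall.1 hy, hx']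
  -- ### smallness of `A₇ √M ρ²` and `A₅ √M ρ²`
  have hsqM : Real.sqrt (256 * K * ε / R ^ 4) = 16 * Real.sqrt (K * ε) / R ^ 2 := by
    rw [show 256 * K * ε / R ^ 4 = (16 * Real.sqrt (K * ε) / R ^ 2) ^ 2 by
      rw [div_pow, mul_pow, Real.sq_sqrt (by positivity)]; ring]
    exact Real.sqrt_sq (by positivity)
  have hsmallKε : ∀ {Aq : ℝ}, 0 < Aq → ε ≤ 16 / (Aq ^ 2 * K) →
      Aq * Real.sqrt (256 * K * ε / R ^ 4) * (R / 8) ^ 2 ≤ 1 := by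
    intro Aq hAq hεq
    have hKε : Real.sqrt (K * ε) ≤ 4 / Aq := by
      rw [← Real.sqrt_sq (by positivity : (0 : ℝ) ≤ 4 / Aq)]
      refine Real.sqrt_le_sqrt ?_
      rw [div_pow]
      calc K * ε ≤ K * (16 / (Aq ^ 2 * K)) := by gcongr
        _ = 4 ^ 2 / Aq ^ 2 := by field_simp; norm_num
    calc Aq * Real.sqrt (256 * K * ε / R ^ 4) * (R / 8) ^ 2 = Aq * Real.sqrt (K * ε) / 4 := by
          rw [hsqM]; field_simp; ring
      _ ≤ Aq * (4 / Aq) / 4 := by gcongr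
      _ = 1 := by field_simp
  have hA₇ρ := hsmallKε hA₇pos hε7
  have hA₅ρ := hsmallKε hA₅pos hε5
  -- ### the parameters of the linear inequality with source
  set θ : ℝ := 1 / (24 * (Fintype.card ι : ℝ) * (R / 8) ^ 2) with hθ
  have hθpos : 0 < θ := by positivity
  set Λ : ℝ := 16 * Real.sqrt 2 * (Fintype.card ι : ℝ) * (1 + (Fintype.card ι : ℝ) ^ 4) *
    Real.sqrt (256 * K * ε / R ^ 4) + 12 * (Fintype.card ι : ℝ) * θ with hΛ
  have hΛ0 : 0 ≤ Λ := by positivity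
  have hΛρ : Λ * (R / 8) ^ 2 ≤ 1 := by
    have h1 : 16 * Real.sqrt 2 * (Fintype.card ι : ℝ) * (1 + (Fintype.card ι : ℝ) ^ 4) *
        Real.sqrt (256 * K * ε / R ^ 4) * (R / 8) ^ 2 ≤ 1 / 2 := by
      have : 16 * Real.sqrt 2 * (Fintype.card ι : ℝ) * (1 + (Fintype.card ι : ℝ) ^ 4) = A₇ / 2 := by
        rw [hA₇]; ring
      rw [this]
      linarith only [hA₇ρ]
    have h2 : 12 * (Fintype.card ι : ℝ) * θ * (R / 8) ^ 2 = 1 / 2 := by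
      rw [hθ]; field_simp; ring
    calc Λ * (R / 8) ^ 2 = 16 * Real.sqrt 2 * (Fintype.card ι : ℝ) * (1 + (Fintype.card ι : ℝ) ^ 4) *
          Real.sqrt (256 * K * ε / R ^ 4) * (R / 8) ^ 2 +
          12 * (Fintype.card ι : ℝ) * θ * (R / 8) ^ 2 := by rw [hΛ]; ring
      _ ≤ 1 / 2 + 1 / 2 := add_le_add h1 h2.le
      _ = 1 := by norm_num
  set S₀ : ℝ := 12 * (Fintype.card ι : ℝ) ^ 5 / θ * N₀ ^ 2 with hS₀
  have hS₀0 : 0 ≤ S₀ := by positivity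
  clear_value S₀ Λ θ
  -- ### the linear subsolution property of `P` on `Q_ρ(t, x)`
  have hsub : ∀ s ∈ Icc (t - (R / 8) ^ 2) t, ∀ y ∈ closedBall x (R / 8),
      deriv (fun s' => (∑ a, ∑ w, ∑ u, ∑ v, ‖covDeriv (A s') (fun y' => covDeriv (A s') (fun z => curvature (A s') z (b u) (b v)) y' (b w)) y (b a)‖ ^ 2)) s -
        ∑ l, fderiv ℝ (fun z => fderiv ℝ (fun y' => (∑ a, ∑ w, ∑ u, ∑ v, ‖covDeriv (A s) (fun y' => covDeriv (A s) (fun z => curvature (A s) z (b u) (b v)) y' (b w)) y' (b a)‖ ^ 2)) z (b l)) y (b l) ≤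
        Λ * (∑ a, ∑ w, ∑ u, ∑ v, ‖covDeriv (A s) (fun y' => covDeriv (A s) (fun z => curvature (A s) z (b u) (b v)) y' (b w)) y (b a)‖ ^ 2) + S₀ := by
    intro s hs y hy
    have hs𝒯 : s ∈ 𝒯 := hI (hIhalf ⟨by nlinarith only [hs.1, hR2], hs.2⟩)
    have hB := deriv_hessDensity_sub_laplacian_le b h𝒯 hA hval hpde hs𝒯 y hθpos
    have hy4 : y ∈ closedBall x (R / 4) := closedBall_subset_closedBall (by linarith) hy
    have hsq : Real.sqrt (ymDensityOfBasis b (A s) y) ≤ Real.sqrt (256 * K * ε / R ^ 4) :=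
      Real.sqrt_le_sqrt (hrege' s hs y hy4)
    have hPy := hP0 s y
    have hNy := hN0 s y
    have hneg : 0 ≤ 2 * ∑ l, ∑ a, ∑ w, ∑ u, ∑ v, ‖covDeriv (A s) (fun y' => covDeriv (A s)
        (fun y'' => covDeriv (A s) (fun z => curvature (A s) z (b u) (b v)) y'' (b w)) y' (b a))
        y (b l)‖ ^ 2 :=
      mul_nonneg zero_le_two (Finset.sum_nonneg fun _ _ => Finset.sum_nonneg fun _ _ =>
        Finset.sum_nonneg fun _ _ => Finset.sum_nonneg fun _ _ => Finset.sum_nonneg fun _ _ =>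
        sq_nonneg _)
    have hcoef : (16 * Real.sqrt 2 * (Fintype.card ι : ℝ) * (1 + (Fintype.card ι : ℝ) ^ 4) *
        Real.sqrt (ymDensityOfBasis b (A s) y) + 12 * (Fintype.card ι : ℝ) * θ) * (∑ a, ∑ w, ∑ u, ∑ v, ‖covDeriv (A s) (fun y' => covDeriv (A s) (fun z => curvature (A s) z (b u) (b v)) y' (b w)) y (b a)‖ ^ 2) ≤
        Λ * (∑ a, ∑ w, ∑ u, ∑ v, ‖covDeriv (A s) (fun y' => covDeriv (A s) (fun z => curvature (A s) z (b u) (b v)) y' (b w)) y (b a)‖ ^ 2) := by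
      refine mul_le_mul_of_nonneg_right ?_ hPy
      rw [hΛ]
      have := mul_le_mul_of_nonneg_left hsq (by positivity :
        (0 : ℝ) ≤ 16 * Real.sqrt 2 * (Fintype.card ι : ℝ) * (1 + (Fintype.card ι : ℝ) ^ 4))
      linarith only [this]
    have hsrc : 12 * (Fintype.card ι : ℝ) ^ 5 / θ * (∑ i, ∑ j, ∑ k, ‖covDeriv (A s) (fun z => curvature (A s) z (b j) (b k)) y (b i)‖ ^ 2) ^ 2 ≤ S₀ := by
      rw [hS₀]
      refine mul_le_mul_of_nonneg_left ?_ (by positivity)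
      exact pow_le_pow_left₀ hNy (hregN s hs y hy4) 2
    have h3 : -(2 * ∑ l, ∑ a, ∑ w, ∑ u, ∑ v, ‖covDeriv (A s) (fun y' => covDeriv (A s)
        (fun y'' => covDeriv (A s) (fun z => curvature (A s) z (b u) (b v)) y'' (b w)) y' (b a))
        y (b l)‖ ^ 2) +
        (16 * Real.sqrt 2 * (Fintype.card ι : ℝ) * (1 + (Fintype.card ι : ℝ) ^ 4) *
          Real.sqrt (ymDensityOfBasis b (A s) y) + 12 * (Fintype.card ι : ℝ) * θ) * (∑ a, ∑ w, ∑ u, ∑ v, ‖covDeriv (A s) (fun y' => covDeriv (A s) (fun z => curvature (A s) z (b u) (b v)) y' (b w)) y (b a)‖ ^ 2) +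
        12 * (Fintype.card ι : ℝ) ^ 5 / θ * (∑ i, ∑ j, ∑ k, ‖covDeriv (A s) (fun z => curvature (A s) z (b j) (b k)) y (b i)‖ ^ 2) ^ 2 ≤ Λ * (∑ a, ∑ w, ∑ u, ∑ v, ‖covDeriv (A s) (fun y' => covDeriv (A s) (fun z => curvature (A s) z (b u) (b v)) y' (b w)) y (b a)‖ ^ 2) + S₀ := by
      linarith only [hneg, hcoef, hsrc]
    exact hB.trans h3
  -- ### the mean-value inequality with source for `P`
  have hIρ : Icc (t - (R / 8) ^ 2) t ⊆ 𝒯 := fun s hs =>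
    hI (hIhalf ⟨by nlinarith only [hs.1, hR2], hs.2⟩)
  have hmv := hMV (q := fun s y => (∑ a, ∑ w, ∑ u, ∑ v, ‖covDeriv (A s) (fun y' => covDeriv (A s) (fun z => curvature (A s) z (b u) (b v)) y' (b w)) y (b a)‖ ^ 2)) h𝒯 hP_joint hρpos hIρ hΛ0 hΛρ hS₀0
    (fun s _ y _ => hP0 s y) hsub
  rw [hE] at hmv
  -- ### the cut-off and the localized `L²` bound for the pair `(N, P)`
  obtain ⟨φ, hφs, hφ0, hφ1, hone, hzero, hφcs, hgrad⟩ := hrad x (R / 8) (R / 4) hρpos (by linarith)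
  have hφC1 : ContDiff ℝ 1 φ := hφs.of_le (natCast_le_infty₁₅ 1)
  have hKφ : ∀ y, ‖fderiv ℝ φ y‖ ≤ 8 * M' / R := fun y => by
    have h := hgrad y
    rwa [show R / 4 - R / 8 = R / 8 by ring, div_div_eq_mul_div, show M' * 8 = 8 * M' by ring] at h
  have htsupp : tsupport φ ⊆ closedBall x (R / 4) := by
    refine closure_minimal (fun y hy => ?_) isClosed_closedBall
    rw [mem_closedBall]
    by_contra h
    exact hy (hzero y (le_of_lt (not_le.1 h)))
  have hφU : ∀ y ∉ closedBall x (R / 4), fderiv ℝ φ y = 0 := fun y hy =>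
    fderiv_eq_zero_of_notMem_tsupport fun h => hy (htsupp h)
  have hφne : ∀ y, φ y ≠ 0 → dist y x < R / 4 := fun y hy =>
    lt_of_not_ge fun h => hy (hzero y h)
  have hle : t - (R / 8) ^ 2 ≤ t := by linarith only [hρ2]
  -- Kato for `N`
  have hkato : ∀ ⦃s : ℝ⦄, s ∈ 𝒯 → ∀ y, ‖fderiv ℝ (fun y' => (∑ i, ∑ j, ∑ k, ‖covDeriv (A s) (fun z => curvature (A s) z (b j) (b k)) y' (b i)‖ ^ 2)) y‖ ^ 2 ≤
      4 * (∑ i, ∑ j, ∑ k, ‖covDeriv (A s) (fun z => curvature (A s) z (b j) (b k)) y (b i)‖ ^ 2) * (∑ a, ∑ w, ∑ u, ∑ v, ‖covDeriv (A s) (fun y' => covDeriv (A s) (fun z => curvature (A s) z (b u) (b v)) y' (b w)) y (b a)‖ ^ 2) := by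
    intro s hs y
    have hsm : ContDiff ℝ ∞ (A s) := contDiff_slice_of_contDiffOn_prod hA hs
    have hA12 : ContDiff ℝ (1 + 2) (A s) := by
      rw [show (1 : WithTop ℕ∞) + 2 = 3 by norm_num]; exact hsm.of_le (natCast_le_infty₁₅ 3)
    have h := norm_fderiv_sum_norm_sq_sq_le (κ := ι × ι × ι) b (A := A s) (hval hs)
      (ψ := fun p z => covDeriv (A s) (fun z' => curvature (A s) z' (b p.2.1) (b p.2.2)) z (b p.1)) y
      (fun p => ((contDiff_covDeriv_curvature_apply (k := 1) hA12 (b p.2.1) (b p.2.2)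
        (b p.1)).differentiable one_ne_zero) y)
    simp only [Fintype.sum_prod_type] at h
    exact h
  -- the differential inequality for `N` on the support of `φ`
  have hineq : ∀ s ∈ Icc (t - (R / 8) ^ 2) t, ∀ y, φ y ≠ 0 →
      deriv (fun s' => (∑ i, ∑ j, ∑ k, ‖covDeriv (A s') (fun z => curvature (A s') z (b j) (b k)) y (b i)‖ ^ 2)) s - ∑ l, fderiv ℝ (fun z => fderiv ℝ (fun y' => (∑ i, ∑ j, ∑ k, ‖covDeriv (A s) (fun z => curvature (A s) z (b j) (b k)) y' (b i)‖ ^ 2)) z (b l)) y (b l) ≤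
        -(2 * (∑ a, ∑ w, ∑ u, ∑ v, ‖covDeriv (A s) (fun y' => covDeriv (A s) (fun z => curvature (A s) z (b u) (b v)) y' (b w)) y (b a)‖ ^ 2)) + A₅ * Real.sqrt (256 * K * ε / R ^ 4) * (∑ i, ∑ j, ∑ k, ‖covDeriv (A s) (fun z => curvature (A s) z (b j) (b k)) y (b i)‖ ^ 2) := by
    intro s hs y hy
    have hs𝒯 : s ∈ 𝒯 := hIρ hs
    have hB := deriv_gradDensity_sub_laplacian_le b h𝒯 hA hval hpde hs𝒯 y
    have hsq : Real.sqrt (ymDensityOfBasis b (A s) y) ≤ Real.sqrt (256 * K * ε / R ^ 4) :=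
      Real.sqrt_le_sqrt (hrege s hs y (hφne y hy))
    have h2 : 24 * Real.sqrt 2 * (Fintype.card ι : ℝ) * Real.sqrt (ymDensityOfBasis b (A s) y) *
        (∑ i, ∑ j, ∑ k, ‖covDeriv (A s) (fun z => curvature (A s) z (b j) (b k)) y (b i)‖ ^ 2) ≤ A₅ * Real.sqrt (256 * K * ε / R ^ 4) * (∑ i, ∑ j, ∑ k, ‖covDeriv (A s) (fun z => curvature (A s) z (b j) (b k)) y (b i)‖ ^ 2) := by
      rw [hA₅]
      exact mul_le_mul_of_nonneg_right (mul_le_mul_of_nonneg_left hsq (by positivity)) (hN0 s y)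
    linarith only [hB, h2]
  have hL2 := intervalIntegral_integral_sq_mul_le_of_subsolution_pair b
    (Q := fun s y => (∑ i, ∑ j, ∑ k, ‖covDeriv (A s) (fun z => curvature (A s) z (b j) (b k)) y (b i)‖ ^ 2)) (H := fun s y => (∑ a, ∑ w, ∑ u, ∑ v, ‖covDeriv (A s) (fun y' => covDeriv (A s) (fun z => curvature (A s) z (b u) (b v)) y' (b w)) y (b a)‖ ^ 2)) h𝒯 hN_joint hP_cont
    (fun s _ y => hN0 s y) (fun s _ y => hP0 s y) hkato hφC1 hφcs
    (isCompact_closedBall x (R / 4)) Subset.rfl measurableSet_closedBall hφU hKφ hle hIρ hineq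
  -- ### bounds for the three terms on the right by `N₀ · vol(B̄_{R/4})`
  have huI : ∀ ⦃s : ℝ⦄, s ∈ 𝒯 → ∀ (c : E) (r : ℝ), IntegrableOn (fun y => (∑ i, ∑ j, ∑ k, ‖covDeriv (A s) (fun z => curvature (A s) z (b j) (b k)) y (b i)‖ ^ 2)) (closedBall c r) :=
    fun s hs c r => (continuous_slice_of_continuousOn_slab hN_cont hs).continuousOn.integrableOn_compact
      (isCompact_closedBall c r)
  have hUu : ∀ s ∈ Icc (t - (R / 8) ^ 2) t, (∫ y in closedBall x (R / 4), (∑ i, ∑ j, ∑ k, ‖covDeriv (A s) (fun z => curvature (A s) z (b j) (b k)) y (b i)‖ ^ 2)) ≤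
      N₀ * ((R / 4) ^ 4 * v₁) := by
    intro s hs
    have hs𝒯 := hIρ hs
    have hV : (volume (closedBall x (R / 4))).toReal = (R / 4) ^ 4 * v₁ := by
      rw [Measure.addHaar_closedBall' volume x (by positivity : (0 : ℝ) ≤ R / 4), ENNReal.toReal_mul,
        ENNReal.toReal_ofReal (by positivity), hE, hv₁]
    have hfin : volume (closedBall x (R / 4)) < ⊤ := (isCompact_closedBall x (R / 4)).measure_lt_top
    calc (∫ y in closedBall x (R / 4), (∑ i, ∑ j, ∑ k, ‖covDeriv (A s) (fun z => curvature (A s) z (b j) (b k)) y (b i)‖ ^ 2)) ≤ ∫ _y in closedBall x (R / 4), N₀ :=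
          setIntegral_mono_on (huI hs𝒯 x (R / 4)) (integrableOn_const hfin.ne)
            measurableSet_closedBall fun y hy => hregN s hs y hy
      _ = N₀ * ((R / 4) ^ 4 * v₁) := by
          rw [setIntegral_const, smul_eq_mul, Measure.real, hV]; ring
  have hφ2u : ∀ s ∈ Icc (t - (R / 8) ^ 2) t,
      (∫ y, φ y ^ 2 * (∑ i, ∑ j, ∑ k, ‖covDeriv (A s) (fun z => curvature (A s) z (b j) (b k)) y (b i)‖ ^ 2)) ≤ ∫ y in closedBall x (R / 4), (∑ i, ∑ j, ∑ k, ‖covDeriv (A s) (fun z => curvature (A s) z (b j) (b k)) y (b i)‖ ^ 2) := by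
    intro s hs
    have hs𝒯 : s ∈ 𝒯 := hIρ hs
    have hus : Continuous fun y => (∑ i, ∑ j, ∑ k, ‖covDeriv (A s) (fun z => curvature (A s) z (b j) (b k)) y (b i)‖ ^ 2) := continuous_slice_of_continuousOn_slab hN_cont hs𝒯
    have hz : ∀ y ∉ closedBall x (R / 4), φ y ^ 2 * (∑ i, ∑ j, ∑ k, ‖covDeriv (A s) (fun z => curvature (A s) z (b j) (b k)) y (b i)‖ ^ 2) = 0 := fun y hy => by
      have : φ y = 0 := hzero y (le_of_lt (not_le.1 (mt mem_closedBall.2 hy)))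
      rw [this]; ring
    rw [← setIntegral_eq_integral_of_forall_compl_eq_zero hz]
    refine setIntegral_mono_on (((hφs.continuous.pow 2).mul hus).continuousOn.integrableOn_compact
      (isCompact_closedBall x (R / 4))) (huI hs𝒯 x (R / 4)) measurableSet_closedBall fun y _ => ?_
    have h1 : φ y ^ 2 ≤ 1 := by nlinarith only [hφ1 y, hφ0 y]
    calc φ y ^ 2 * (∑ i, ∑ j, ∑ k, ‖covDeriv (A s) (fun z => curvature (A s) z (b j) (b k)) y (b i)‖ ^ 2) ≤ 1 * (∑ i, ∑ j, ∑ k, ‖covDeriv (A s) (fun z => curvature (A s) z (b j) (b k)) y (b i)‖ ^ 2) := mul_le_mul_of_nonneg_right h1 (hN0 s y)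
      _ = _ := one_mul _
  have hEUc : ContinuousOn (fun s => ∫ y in closedBall x (R / 4), (∑ i, ∑ j, ∑ k, ‖covDeriv (A s) (fun z => curvature (A s) z (b j) (b k)) y (b i)‖ ^ 2)) 𝒯 :=
    continuousOn_setIntegral_of_continuousOn_slab h𝒯 (g := fun p : ℝ × E => (∑ i, ∑ j, ∑ k, ‖covDeriv (A p.1) (fun z => curvature (A p.1) z (b j) (b k)) p.2 (b i)‖ ^ 2))
      hN_cont (isCompact_closedBall x (R / 4)) Subset.rfl measurableSet_closedBall
  have hφ2s : HasCompactSupport fun y => φ y ^ 2 := hasCompactSupport_sq hφcs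
  have hφ2c : Continuous fun y => φ y ^ 2 := hφs.continuous.pow 2
  have hYc : ContinuousOn (fun s => ∫ y, φ y ^ 2 * (∑ i, ∑ j, ∑ k, ‖covDeriv (A s) (fun z => curvature (A s) z (b j) (b k)) y (b i)‖ ^ 2)) 𝒯 :=
    continuousOn_integral_mul_of_continuousOn_slab h𝒯 (g := fun p : ℝ × E => (∑ i, ∑ j, ∑ k, ‖covDeriv (A p.1) (fun z => curvature (A p.1) z (b j) (b k)) p.2 (b i)‖ ^ 2))
      hN_cont hφ2c hφ2s
  have hGc : ContinuousOn (fun s => ∫ y, φ y ^ 2 * (∑ a, ∑ w, ∑ u, ∑ v, ‖covDeriv (A s) (fun y' => covDeriv (A s) (fun z => curvature (A s) z (b u) (b v)) y' (b w)) y (b a)‖ ^ 2)) 𝒯 :=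
    continuousOn_integral_mul_of_continuousOn_slab h𝒯 (g := fun p : ℝ × E => (∑ a, ∑ w, ∑ u, ∑ v, ‖covDeriv (A p.1) (fun y' => covDeriv (A p.1) (fun z => curvature (A p.1) z (b u) (b v)) y' (b w)) p.2 (b a)‖ ^ 2))
      hP_cont hφ2c hφ2s
  have hBc : ContinuousOn (fun s => ∫ y in closedBall x (R / 8), (∑ a, ∑ w, ∑ u, ∑ v, ‖covDeriv (A s) (fun y' => covDeriv (A s) (fun z => curvature (A s) z (b u) (b v)) y' (b w)) y (b a)‖ ^ 2)) 𝒯 :=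
    continuousOn_setIntegral_of_continuousOn_slab h𝒯 (g := fun p : ℝ × E => (∑ a, ∑ w, ∑ u, ∑ v, ‖covDeriv (A p.1) (fun y' => covDeriv (A p.1) (fun z => curvature (A p.1) z (b u) (b v)) y' (b w)) p.2 (b a)‖ ^ 2))
      hP_cont (isCompact_closedBall x (R / 8)) Subset.rfl measurableSet_closedBall
  have hIi : ∀ ⦃f : ℝ → ℝ⦄, ContinuousOn f 𝒯 → IntervalIntegrable f volume (t - (R / 8) ^ 2) t :=
    fun f hf => ContinuousOn.intervalIntegrable (by rw [uIcc_of_le hle]; exact hf.mono hIρ)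
  set W : ℝ := N₀ * ((R / 4) ^ 4 * v₁) with hW
  have hW0 : 0 ≤ W := mul_nonneg hN₀0 (by positivity)
  clear_value W
  -- (T2) `∫∫_U N ≤ ρ² W`
  have hT2 : (∫ s in (t - (R / 8) ^ 2)..t, ∫ y in closedBall x (R / 4), (∑ i, ∑ j, ∑ k, ‖covDeriv (A s) (fun z => curvature (A s) z (b j) (b k)) y (b i)‖ ^ 2)) ≤ (R / 8) ^ 2 * W := by
    calc (∫ s in (t - (R / 8) ^ 2)..t, ∫ y in closedBall x (R / 4), (∑ i, ∑ j, ∑ k, ‖covDeriv (A s) (fun z => curvature (A s) z (b j) (b k)) y (b i)‖ ^ 2))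
        ≤ ∫ _s in (t - (R / 8) ^ 2)..t, W :=
          intervalIntegral.integral_mono_on hle (hIi hEUc) intervalIntegrable_const fun s hs => hUu s hs
      _ = (R / 8) ^ 2 * W := by rw [intervalIntegral.integral_const, smul_eq_mul]; ring
  -- (T3) `∫∫ φ² N ≤ ρ² W`
  have hT3 : (∫ s in (t - (R / 8) ^ 2)..t, ∫ y, φ y ^ 2 * (∑ i, ∑ j, ∑ k, ‖covDeriv (A s) (fun z => curvature (A s) z (b j) (b k)) y (b i)‖ ^ 2)) ≤ (R / 8) ^ 2 * W :=
    (intervalIntegral.integral_mono_on hle (hIi hYc) (hIi hEUc) fun s hs => hφ2u s hs).trans hT2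
  -- (T1) `∫ φ² N(t − ρ²) ≤ W`
  have hT1 : (∫ y, φ y ^ 2 * (∑ i, ∑ j, ∑ k, ‖covDeriv (A (t - (R / 8) ^ 2)) (fun z => curvature (A (t - (R / 8) ^ 2)) z (b j) (b k)) y (b i)‖ ^ 2)) ≤ W :=
    (hφ2u _ (left_mem_Icc.2 hle)).trans (hUu _ (left_mem_Icc.2 hle))
  -- the right-hand side of the `L²` bound is `≤ (2 + 4 M'²) W`
  have h44 : (0 : ℝ) ≤ 4 * (8 * M' / R) ^ 2 := by positivity
  have h2a := mul_le_mul_of_nonneg_left hT2 h44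
  have e2 : 4 * (8 * M' / R) ^ 2 * ((R / 8) ^ 2 * W) = 4 * M' ^ 2 * W := by
    clear * - hR
    field_simp
  have hAM0 : (0 : ℝ) ≤ A₅ * Real.sqrt (256 * K * ε / R ^ 4) := by positivity
  have h3a := mul_le_mul_of_nonneg_left hT3 hAM0
  have h3b : A₅ * Real.sqrt (256 * K * ε / R ^ 4) * ((R / 8) ^ 2 * W) ≤ W := by
    rw [← mul_assoc]
    exact mul_le_of_le_one_left hW0 hA₅ρ
  have hRHS : (∫ y, φ y ^ 2 * (∑ i, ∑ j, ∑ k, ‖covDeriv (A (t - (R / 8) ^ 2)) (fun z => curvature (A (t - (R / 8) ^ 2)) z (b j) (b k)) y (b i)‖ ^ 2)) +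
      4 * (8 * M' / R) ^ 2 * (∫ s in (t - (R / 8) ^ 2)..t, ∫ y in closedBall x (R / 4), (∑ i, ∑ j, ∑ k, ‖covDeriv (A s) (fun z => curvature (A s) z (b j) (b k)) y (b i)‖ ^ 2)) +
      A₅ * Real.sqrt (256 * K * ε / R ^ 4) *
        (∫ s in (t - (R / 8) ^ 2)..t, ∫ y, φ y ^ 2 * (∑ i, ∑ j, ∑ k, ‖covDeriv (A s) (fun z => curvature (A s) z (b j) (b k)) y (b i)‖ ^ 2)) ≤ (2 + 4 * M' ^ 2) * W := by
    linarith only [hT1, h2a, e2, h3a, h3b]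
  -- ### the left-hand side: `∫∫_{Q_ρ} P ≤ ∫∫ φ² P`
  have hLHS : (∫ s in (t - (R / 8) ^ 2)..t, ∫ y in closedBall x (R / 8), (∑ a, ∑ w, ∑ u, ∑ v, ‖covDeriv (A s) (fun y' => covDeriv (A s) (fun z => curvature (A s) z (b u) (b v)) y' (b w)) y (b a)‖ ^ 2)) ≤
      ∫ s in (t - (R / 8) ^ 2)..t, ∫ y, φ y ^ 2 * (∑ a, ∑ w, ∑ u, ∑ v, ‖covDeriv (A s) (fun y' => covDeriv (A s) (fun z => curvature (A s) z (b u) (b v)) y' (b w)) y (b a)‖ ^ 2) := by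
    refine intervalIntegral.integral_mono_on hle (hIi hBc) (hIi hGc) fun s hs => ?_
    have hs𝒯 : s ∈ 𝒯 := hIρ hs
    have hHs : Continuous fun y => (∑ a, ∑ w, ∑ u, ∑ v, ‖covDeriv (A s) (fun y' => covDeriv (A s) (fun z => curvature (A s) z (b u) (b v)) y' (b w)) y (b a)‖ ^ 2) := continuous_slice_of_continuousOn_slab hP_cont hs𝒯
    have hfi : Integrable fun y => φ y ^ 2 * (∑ a, ∑ w, ∑ u, ∑ v, ‖covDeriv (A s) (fun y' => covDeriv (A s) (fun z => curvature (A s) z (b u) (b v)) y' (b w)) y (b a)‖ ^ 2) :=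
      (hφ2c.mul hHs).integrable_of_hasCompactSupport hφ2s.mul_right
    calc (∫ y in closedBall x (R / 8), (∑ a, ∑ w, ∑ u, ∑ v, ‖covDeriv (A s) (fun y' => covDeriv (A s) (fun z => curvature (A s) z (b u) (b v)) y' (b w)) y (b a)‖ ^ 2))
        = ∫ y in closedBall x (R / 8), φ y ^ 2 * (∑ a, ∑ w, ∑ u, ∑ v, ‖covDeriv (A s) (fun y' => covDeriv (A s) (fun z => curvature (A s) z (b u) (b v)) y' (b w)) y (b a)‖ ^ 2) :=
          setIntegral_congr_fun measurableSet_closedBall fun y hy => by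
            rw [hone y (mem_closedBall.1 hy), one_pow, one_mul]
      _ ≤ ∫ y, φ y ^ 2 * (∑ a, ∑ w, ∑ u, ∑ v, ‖covDeriv (A s) (fun y' => covDeriv (A s) (fun z => curvature (A s) z (b u) (b v)) y' (b w)) y (b a)‖ ^ 2) :=
          setIntegral_le_integral hfi (ae_of_all _ fun y => mul_nonneg (sq_nonneg _) (hP0 s y))
  -- ### assemble
  have hchain : (∫ s in (t - (R / 8) ^ 2)..t, ∫ y in closedBall x (R / 8), (∑ a, ∑ w, ∑ u, ∑ v, ‖covDeriv (A s) (fun y' => covDeriv (A s) (fun z => curvature (A s) z (b u) (b v)) y' (b w)) y (b a)‖ ^ 2)) ≤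
      (2 + 4 * M' ^ 2) * W := hLHS.trans (hL2.trans hRHS)
  have hρ6 : 0 < (R / 8) ^ (4 + 2) := by positivity
  have hmain : (∑ a, ∑ w, ∑ u, ∑ v, ‖covDeriv (A t) (fun y' => covDeriv (A t) (fun z => curvature (A t) z (b u) (b v)) y' (b w)) x (b a)‖ ^ 2) ≤ Cmv / (R / 8) ^ (4 + 2) * ((2 + 4 * M' ^ 2) * W) + Cmv * S₀ * (R / 8) ^ 2 :=
    hmv.trans (add_le_add (mul_le_mul_of_nonneg_left hchain (div_nonneg hCmv.le hρ6.le)) le_rfl)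
  -- evaluate the two terms
  have hterm1 : Cmv / (R / 8) ^ (4 + 2) * ((2 + 4 * M' ^ 2) * W) =
      Cmv * Ca * (8 ^ 6 * (2 + 4 * M' ^ 2) * v₁ / 4) * ε / R ^ 8 := by
    clear * - hR hW hN₀def
    rw [hW, hN₀def, show (4 : ℕ) + 2 = 6 from rfl]
    field_simp
    ring
  have hterm2 : Cmv * S₀ * (R / 8) ^ 2 = Cmv * Ca * (288 * (Fintype.card ι : ℝ) ^ 6 * Ca) * ε ^ 2 / R ^ 8 := by
    clear * - hR hS₀ hθ hN₀def hcardpos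
    rw [hS₀, hθ, hN₀def]
    field_simp
    ring
  rw [hterm1, hterm2] at hmain
  have hε1' : Cmv * Ca * (288 * (Fintype.card ι : ℝ) ^ 6 * Ca) * ε ^ 2 / R ^ 8 ≤
      Cmv * Ca * (288 * (Fintype.card ι : ℝ) ^ 6 * Ca) * ε / R ^ 8 := by
    rw [div_le_div_iff_of_pos_right hR8]
    have h0 : 0 ≤ Cmv * Ca * (288 * (Fintype.card ι : ℝ) ^ 6 * Ca) * ε := by positivity
    nlinarith only [h0, hε1, hε0]
  have hfinal : Cmv * Ca * (8 ^ 6 * (2 + 4 * M' ^ 2) * v₁ / 4) * ε / R ^ 8 +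
      Cmv * Ca * (288 * (Fintype.card ι : ℝ) ^ 6 * Ca) * ε / R ^ 8 ≤ C * ε / R ^ 8 := by
    clear * - hC hR8 hε0 hCmv hCa
    rw [← add_div, div_le_div_iff_of_pos_right hR8, hC]
    nlinarith only [hε0, hCmv, hCa]
  linarith only [hmain, hε1', hfinal]

end HessRegularity

end Literature.MathematicalPhysics.QuantumLattice
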